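import Literature.NumberTheory.Automorphic.RatIdeleCongruence
import Literature.NumberTheory.Automorphic.MeyerDifferenceRepresentation
import HarnessLib

/-!
# Bridge: `Rat.finiteIntegralUnits = Meyer.integralFiniteUnits ℚ`

Topic `NumberTheory/Automorphic`; a two-import bridge (theorem only). The subgroup `ẑˣ ≤ (𝔸_ℚ^∞)ˣ`
is spelt `Rat.finiteIntegralUnits` (carrier `|y_v|_v = 1`) in `RatIdeleCongruence`, whose import
cone is kept light for the new-vector existence proof, and `Meyer.integralFiniteUnits K` (carrier
`u_v, u_v⁻¹ ∈ 𝒪_v`, Meyer's `𝒪ˣ_{∁S}`) in `MeyerDifferenceRepresentation`; this file, which imports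
both, records that for `K = ℚ` they are the same subgroup, so that the two names cannot drift apart.
-/

noncomputable section

open NumberField IsDedekindDomain

namespace Literature.NumberTheory.Automorphic

/-- **`Rat.finiteIntegralUnits = Meyer.integralFiniteUnits ℚ`**: `|y_v|_v = 1` for all `v` iff `y_v` and
`y_v⁻¹` are `v`-integral for all `v` (`|y_v|_v |y_v⁻¹|_v = 1`). [folklore] -/
theorem Rat.finiteIntegralUnits_eq_integralFiniteUnits :
    Rat.finiteIntegralUnits = Meyer.integralFiniteUnits ℚ := by
  ext y
  change (∀ v : HeightOneSpectrum (𝓞 ℚ), Valued.v ((y : FiniteAdeleRing (𝓞 ℚ) ℚ) v) = 1) ↔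
    ∀ v : HeightOneSpectrum (𝓞 ℚ), (y : FiniteAdeleRing (𝓞 ℚ) ℚ) v ∈ v.adicCompletionIntegers ℚ ∧
      ((y⁻¹ : (FiniteAdeleRing (𝓞 ℚ) ℚ)ˣ) : FiniteAdeleRing (𝓞 ℚ) ℚ) v ∈ v.adicCompletionIntegers ℚ
  have hmul : ∀ v : HeightOneSpectrum (𝓞 ℚ),
      Valued.v ((y : FiniteAdeleRing (𝓞 ℚ) ℚ) v) *
        Valued.v (((y⁻¹ : (FiniteAdeleRing (𝓞 ℚ) ℚ)ˣ) : FiniteAdeleRing (𝓞 ℚ) ℚ) v) = 1 := fun v => by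
    rw [← Valuation.map_mul, ← FiniteAdeleRing.mul_apply', Units.mul_inv]
    exact Valuation.map_one _
  constructor
  · intro h v
    have h1 := h v
    have h2 : Valued.v (((y⁻¹ : (FiniteAdeleRing (𝓞 ℚ) ℚ)ˣ) : FiniteAdeleRing (𝓞 ℚ) ℚ) v) = 1 := by
      have := hmul v
      rwa [h1, one_mul] at this
    exact ⟨(HeightOneSpectrum.mem_adicCompletionIntegers (𝓞 ℚ) ℚ v).2 h1.le,
      (HeightOneSpectrum.mem_adicCompletionIntegers (𝓞 ℚ) ℚ v).2 h2.le⟩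
  · intro h v
    have h1 : Valued.v ((y : FiniteAdeleRing (𝓞 ℚ) ℚ) v) ≤ 1 :=
      (HeightOneSpectrum.mem_adicCompletionIntegers (𝓞 ℚ) ℚ v).1 (h v).1
    have h2 : Valued.v (((y⁻¹ : (FiniteAdeleRing (𝓞 ℚ) ℚ)ˣ) : FiniteAdeleRing (𝓞 ℚ) ℚ) v) ≤ 1 :=
      (HeightOneSpectrum.mem_adicCompletionIntegers (𝓞 ℚ) ℚ v).1 (h v).2
    refine le_antisymm h1 ?_
    -- `1 = |y_v| |y_v⁻¹| ≤ |y_v| · 1`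
    calc (1 : WithZero (Multiplicative ℤ)) = Valued.v ((y : FiniteAdeleRing (𝓞 ℚ) ℚ) v) *
          Valued.v (((y⁻¹ : (FiniteAdeleRing (𝓞 ℚ) ℚ)ˣ) : FiniteAdeleRing (𝓞 ℚ) ℚ) v) := (hmul v).symm
      _ ≤ Valued.v ((y : FiniteAdeleRing (𝓞 ℚ) ℚ) v) * 1 := mul_le_mul' le_rfl h2
      _ = Valued.v ((y : FiniteAdeleRing (𝓞 ℚ) ℚ) v) := mul_one _

end Literature.NumberTheory.Automorphic

end
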